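import Summits.Ventures.CertifiedManyBodySolver.Downfold.EmeryFermiFillingRows
import HarnessLib

/-!
# The Brillouin-zone fraction of a BILINEAR sublevel region `{k : 0 ≤ A − 4D(x + y) − 16N·xy}`: monotonicity, scale
# invariance, and the two counting theorems (finset and row-threshold form)

Venture CertifiedManyBodySolver, cell `pub/hubbard-downfold` (stage S1, HUMAN RULINGS D-0096/D-0098: the three-band → one-band
reduction error is carried explicitly), seat hubbard-downfold-mod-4 (technique B = band level); namespace
`Summit.Ventures.CertifiedManyBodySolver.Downfold.Emery`. Everything here is PROVED. WHAT THIS IS NOT: a statement about any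
material; no number lives here; pure measure theory + interval arithmetic on the half-angle grid of `EmeryFermiFilling`.

`EmeryFermiFillingCount` / `EmeryFermiFillingRows` count grid cells for the OCCUPIED SET `{ε_AB(k) ≤ ε}` of the σ three-band
antibonding band, whose membership is decided through the bilinear secular function `cA − 4fsD(x + y) − 16fsN·xy`
(`EmeryFermiSurfaceShape.charCubic_bilinear`, `x = sin²(kx/2)`, `y = sin²(ky/2)`) plus Taylor side conditions. Here the bilinear
sublevel region ITSELF is the object:

* §1 `bilin A D N x y = A − 4D(x + y) − 16N·xy`, `bilinRegion A D N = {k ∈ [0, π]² : 0 ≤ bilin(x(k₁), y(k₂))}`,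
  `bilinFrac A D N = |bilinRegion|/π²` (Lebesgue); `bilinFrac ∈ [0, 1]`; ANTITONE in `N` and in `D`, MONOTONE in `A` (set inclusion,
  `x, y ≥ 0`); invariant under a common positive rescaling of `(A, D, N)` (`bilinRegion_smul`).
* §2 the counting theorems WITHOUT Taylor conditions (membership is the sign of `bilin` itself): `card(innerFlaggedB)/K² ≤ bilinFrac`
  (cells with `innerVal ≥ 0` at the upper-right corner, `EmeryFermiFillingCount.innerVal`) and `bilinFrac ≤ card(outerFlagged)/K²`
  (`EmeryFermiFillingCount.outerFlagged`, cells not excluded by `outerVal < 0` at the lower-left corner); row-threshold forms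
  `rowSum jin/K² ≤ bilinFrac` (`rowInnerCheckB`) and `bilinFrac ≤ rowSum jout/K²` (`EmeryFermiFillingRows.rowOuterCheck`, reused as is).

Consumer: `EmeryVanHoveFactorisation` — at the saddle energy the occupied set of the σ model IS a bilinear region with
`(A, D, N) ∝ (4, 1, q)`, so the van Hove doping is a universal function of one number `q`, tabulated once (`EmeryVanHoveTable`).
Sources: interval arithmetic [folklore] (R. E. Moore, Interval Analysis, 1966, Ch. 2–4); the `(x, y)` contour language
[AndersenEtAl1995, §6].
-/

noncomputable section

namespace Summit.Ventures.CertifiedManyBodySolver.Downfold.Emery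

open Real MeasureTheory Set

/-! ## §1 The bilinear region and its Brillouin-zone fraction -/

/-- The bilinear form `A − 4D(x + y) − 16N·xy` of the `(x, y)` contour language. [cite: AndersenEtAl1995, §6] -/
def bilin (A D N x y : ℝ) : ℝ := A - 4 * D * (x + y) - 16 * N * (x * y)

/-- The bilinear SUBLEVEL REGION in the quadrant `[0, π]²`: momenta with `0 ≤ A − 4D(x + y) − 16N·xy`,
`x = sin²(k₁/2)`, `y = sin²(k₂/2)`. [cite: AndersenEtAl1995, §6] -/
def bilinRegion (A D N : ℝ) : Set (ℝ × ℝ) :=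
  {k | k ∈ Icc (0 : ℝ) π ×ˢ Icc (0 : ℝ) π ∧ 0 ≤ bilin A D N (halfSq k.1) (halfSq k.2)}

/-- The Brillouin-zone FRACTION of the bilinear region (Lebesgue measure over `π²`). [folklore] -/
def bilinFrac (A D N : ℝ) : ℝ := (volume (bilinRegion A D N)).toReal / π ^ 2

/-- The region sits in the quadrant. [folklore] -/
theorem bilinRegion_subset_quadrant (A D N : ℝ) : bilinRegion A D N ⊆ Icc (0 : ℝ) π ×ˢ Icc (0 : ℝ) π :=
  fun _ hk => hk.1

/-- The region has measure at most `π²`. [folklore] -/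
theorem volume_bilinRegion_le (A D N : ℝ) :
    volume (bilinRegion A D N) ≤ ENNReal.ofReal (π - 0) * ENNReal.ofReal (π - 0) := by
  rw [← volume_Icc_prod_Icc]
  exact measure_mono (bilinRegion_subset_quadrant A D N)

/-- [folklore] -/
theorem volume_bilinRegion_ne_top (A D N : ℝ) : volume (bilinRegion A D N) ≠ ⊤ :=
  ne_top_of_le_ne_top (ENNReal.mul_ne_top ENNReal.ofReal_ne_top ENNReal.ofReal_ne_top) (volume_bilinRegion_le A D N)

/-- `0 ≤ bilinFrac`. [folklore] -/
theorem bilinFrac_nonneg (A D N : ℝ) : 0 ≤ bilinFrac A D N := by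
  unfold bilinFrac; positivity

/-- `bilinFrac ≤ 1`. [folklore] -/
theorem bilinFrac_le_one (A D N : ℝ) : bilinFrac A D N ≤ 1 := by
  unfold bilinFrac
  have hπ := Real.pi_pos
  have h := (ENNReal.toReal_le_toReal (volume_bilinRegion_ne_top A D N)
    (ENNReal.mul_ne_top ENNReal.ofReal_ne_top ENNReal.ofReal_ne_top)).2 (volume_bilinRegion_le A D N)
  rw [ENNReal.toReal_mul, ENNReal.toReal_ofReal (by linarith), sub_zero] at h
  rw [div_le_one (by positivity)]
  nlinarith

/-- Monotonicity of the fraction under inclusion of regions. [folklore] -/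
theorem bilinFrac_mono_of_subset {A D N A' D' N' : ℝ} (h : bilinRegion A D N ⊆ bilinRegion A' D' N') :
    bilinFrac A D N ≤ bilinFrac A' D' N' := by
  unfold bilinFrac
  exact div_le_div_of_nonneg_right
    (ENNReal.toReal_mono (volume_bilinRegion_ne_top A' D' N') (measure_mono h)) (by positivity)

/-- The region SHRINKS as `N` grows (`xy ≥ 0`). [folklore] -/
theorem bilinRegion_anti_N (A D : ℝ) {N₁ N₂ : ℝ} (h : N₁ ≤ N₂) : bilinRegion A D N₂ ⊆ bilinRegion A D N₁ := by
  intro k hk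
  refine ⟨hk.1, ?_⟩
  have hxy : 0 ≤ halfSq k.1 * halfSq k.2 := mul_nonneg (halfSq_nonneg _) (halfSq_nonneg _)
  have := hk.2
  unfold bilin at this ⊢
  nlinarith [mul_le_mul_of_nonneg_right h hxy]

/-- The region SHRINKS as `D` grows (`x + y ≥ 0`). [folklore] -/
theorem bilinRegion_anti_D (A N : ℝ) {D₁ D₂ : ℝ} (h : D₁ ≤ D₂) : bilinRegion A D₂ N ⊆ bilinRegion A D₁ N := by
  intro k hk
  refine ⟨hk.1, ?_⟩
  have hxy : 0 ≤ halfSq k.1 + halfSq k.2 := add_nonneg (halfSq_nonneg _) (halfSq_nonneg _)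
  have := hk.2
  unfold bilin at this ⊢
  nlinarith [mul_le_mul_of_nonneg_right h hxy]

/-- The region GROWS with `A`. [folklore] -/
theorem bilinRegion_mono_A (D N : ℝ) {A₁ A₂ : ℝ} (h : A₁ ≤ A₂) : bilinRegion A₁ D N ⊆ bilinRegion A₂ D N := by
  intro k hk
  refine ⟨hk.1, ?_⟩
  have := hk.2
  unfold bilin at this ⊢
  linarith

/-- `bilinFrac` is antitone in `N`. [folklore] -/
theorem bilinFrac_anti_N (A D : ℝ) {N₁ N₂ : ℝ} (h : N₁ ≤ N₂) : bilinFrac A D N₂ ≤ bilinFrac A D N₁ :=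
  bilinFrac_mono_of_subset (bilinRegion_anti_N A D h)

/-- `bilinFrac` is antitone in `D`. [folklore] -/
theorem bilinFrac_anti_D (A N : ℝ) {D₁ D₂ : ℝ} (h : D₁ ≤ D₂) : bilinFrac A D₂ N ≤ bilinFrac A D₁ N :=
  bilinFrac_mono_of_subset (bilinRegion_anti_D A N h)

/-- `bilinFrac` is monotone in `A`. [folklore] -/
theorem bilinFrac_mono_A (D N : ℝ) {A₁ A₂ : ℝ} (h : A₁ ≤ A₂) : bilinFrac A₁ D N ≤ bilinFrac A₂ D N :=
  bilinFrac_mono_of_subset (bilinRegion_mono_A D N h)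

/-- Common positive RESCALING of `(A, D, N)` rescales `bilin`. [folklore] -/
theorem bilin_smul (l A D N x y : ℝ) : bilin (l * A) (l * D) (l * N) x y = l * bilin A D N x y := by
  unfold bilin; ring

/-- SCALE INVARIANCE of the region: `bilinRegion (λA) (λD) (λN) = bilinRegion A D N` for `λ > 0`. [folklore] -/
theorem bilinRegion_smul {l : ℝ} (hl : 0 < l) (A D N : ℝ) :
    bilinRegion (l * A) (l * D) (l * N) = bilinRegion A D N := by
  ext k
  simp only [bilinRegion, Set.mem_setOf_eq, bilin_smul]
  constructor
  · rintro ⟨hq, h⟩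
    exact ⟨hq, nonneg_of_mul_nonneg_right (by linarith) hl⟩
  · rintro ⟨hq, h⟩
    exact ⟨hq, mul_nonneg hl.le h⟩

/-- [folklore] -/
theorem bilinFrac_smul {l : ℝ} (hl : 0 < l) (A D N : ℝ) : bilinFrac (l * A) (l * D) (l * N) = bilinFrac A D N := by
  unfold bilinFrac; rw [bilinRegion_smul hl]

/-! ## §2 The two counting theorems (no Taylor side condition: membership is the sign of `bilin` itself) -/

/-- The inner-flagged cells of the bilinear region: `0 ≤ innerVal` at the upper-right corner enclosure. [folklore] -/
def innerFlaggedB (K : ℕ) (xh : ℕ → ℚ) (A D N : ℚ) : Finset (ℕ × ℕ) :=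
  (Finset.range K ×ˢ Finset.range K).filter fun ij => 0 ≤ innerVal xh A D N ij

/-- **INNER COUNTING THEOREM** (`0 ≤ D`, `0 ≤ N`): every inner-flagged cell lies in the region, hence
`card(innerFlaggedB)/K² ≤ bilinFrac A D N`. [folklore] -/
theorem card_innerFlaggedB_le_bilinFrac {K : ℕ} (hK : 0 < K) {xl xh : ℕ → ℚ} (hG : GridEncl K xl xh)
    {A D N : ℚ} (hD0 : 0 ≤ D) (hN0 : 0 ≤ N) :
    ((innerFlaggedB K xh A D N).card : ℝ) / (K : ℝ) ^ 2 ≤ bilinFrac A D N := by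
  set F := innerFlaggedB K xh A D N with hF
  have hKr : (0 : ℝ) < K := by exact_mod_cast hK
  have hπ := Real.pi_pos
  have hD0r : (0 : ℝ) ≤ D := by exact_mod_cast hD0
  have hN0r : (0 : ℝ) ≤ N := by exact_mod_cast hN0
  -- each flagged cell is inside the region
  have hsub : (⋃ ij ∈ F, cellIco K ij) ⊆ bilinRegion A D N := by
    intro k hk
    simp only [Set.mem_iUnion, exists_prop] at hk
    obtain ⟨ij, hij, hk⟩ := hk
    rw [hF, innerFlaggedB, Finset.mem_filter, Finset.mem_product, Finset.mem_range, Finset.mem_range] at hij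
    obtain ⟨⟨hi, hj⟩, hval⟩ := hij
    obtain ⟨⟨h1lo, h1hi⟩, ⟨h2lo, h2hi⟩⟩ := hk
    have hi1 : ij.1 + 1 ≤ K := hi
    have hj1 : ij.2 + 1 ≤ K := hj
    have hk1π : k.1 ≤ π := h1hi.le.trans (gridPt_le_pi hK hi1)
    have hk2π : k.2 ≤ π := h2hi.le.trans (gridPt_le_pi hK hj1)
    have hk10 : 0 ≤ k.1 := (gridPt_nonneg K ij.1).trans h1lo
    have hk20 : 0 ≤ k.2 := (gridPt_nonneg K ij.2).trans h2lo
    refine ⟨⟨⟨hk10, hk1π⟩, ⟨hk20, hk2π⟩⟩, ?_⟩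
    set x := halfSq k.1
    set y := halfSq k.2
    have hxX : x ≤ (xh (ij.1 + 1) : ℝ) :=
      (halfSq_mono hk10 h1hi.le (gridPt_le_pi hK hi1)).trans (hG _ hi1).2.2
    have hyY : y ≤ (xh (ij.2 + 1) : ℝ) :=
      (halfSq_mono hk20 h2hi.le (gridPt_le_pi hK hj1)).trans (hG _ hj1).2.2
    have hx0 : 0 ≤ x := halfSq_nonneg _
    have hy0 : 0 ≤ y := halfSq_nonneg _
    have hval' : (0 : ℝ) ≤ innerVal xh A D N ij := by exact_mod_cast hval
    simp only [innerVal, Rat.cast_sub, Rat.cast_mul, Rat.cast_add, Rat.cast_ofNat] at hval'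
    have h1 := bilin_antitone (A := (A : ℝ)) hD0r hN0r hx0 hy0 hxX hyY
    show 0 ≤ bilin (A : ℝ) D N x y
    unfold bilin
    linarith
  -- measure of the union of flagged cells
  have hvol : volume (⋃ ij ∈ F, cellIco K ij) =
      (F.card : ENNReal) * (ENNReal.ofReal (π / K) * ENNReal.ofReal (π / K)) := by
    rw [measure_biUnion_finset (fun ij _ ij' _ hne => cellIco_disjoint K hne)
      (fun ij _ => measurableSet_cellIco K ij)]
    simp only [volume_cellIco hK, Finset.sum_const, nsmul_eq_mul]
  have hle : (F.card : ENNReal) * (ENNReal.ofReal (π / K) * ENNReal.ofReal (π / K))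
      ≤ volume (bilinRegion (A : ℝ) D N) := hvol ▸ measure_mono hsub
  have hfin := volume_bilinRegion_ne_top (A : ℝ) D N
  have hreal : (F.card : ℝ) * (π / K * (π / K)) ≤ (volume (bilinRegion (A : ℝ) D N)).toReal := by
    have := (ENNReal.toReal_le_toReal (by
      exact ENNReal.mul_ne_top (ENNReal.natCast_ne_top _)
        (ENNReal.mul_ne_top ENNReal.ofReal_ne_top ENNReal.ofReal_ne_top)) hfin).2 hle
    rw [ENNReal.toReal_mul, ENNReal.toReal_mul, ENNReal.toReal_natCast,
      ENNReal.toReal_ofReal (by positivity)] at this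
    exact this
  unfold bilinFrac
  rw [div_le_div_iff₀ (by positivity) (by positivity)]
  have hKK : (π / K * (π / K)) * (K : ℝ) ^ 2 = π ^ 2 := by field_simp
  calc (F.card : ℝ) * π ^ 2 = (F.card : ℝ) * (π / K * (π / K)) * (K : ℝ) ^ 2 := by rw [mul_assoc, hKK]
    _ ≤ (volume (bilinRegion (A : ℝ) D N)).toReal * (K : ℝ) ^ 2 := mul_le_mul_of_nonneg_right hreal (by positivity)

/-- **OUTER COUNTING THEOREM** (`0 ≤ D`, `0 ≤ N`): the region is covered by the outer-flagged closed cells of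
`EmeryFermiFillingCount.outerFlagged`, hence `bilinFrac A D N ≤ card(outerFlagged)/K²`. [folklore] -/
theorem bilinFrac_le_card_outerFlagged {K : ℕ} (hK : 0 < K) {xl xh : ℕ → ℚ} (hG : GridEncl K xl xh)
    {A D N : ℚ} (hD0 : 0 ≤ D) (hN0 : 0 ≤ N) :
    bilinFrac A D N ≤ ((outerFlagged K xl A D N).card : ℝ) / (K : ℝ) ^ 2 := by
  set F := outerFlagged K xl A D N with hF
  have hKr : (0 : ℝ) < K := by exact_mod_cast hK
  have hπ := Real.pi_pos
  have hD0r : (0 : ℝ) ≤ D := by exact_mod_cast hD0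
  have hN0r : (0 : ℝ) ≤ N := by exact_mod_cast hN0
  have hcov : bilinRegion (A : ℝ) D N ⊆ ⋃ ij ∈ F, cellIcc K ij := by
    rintro ⟨k1, k2⟩ ⟨⟨⟨h10, h1π⟩, ⟨h20, h2π⟩⟩, hocc⟩
    obtain ⟨i, hi, hi1, hi2⟩ := exists_gridIndex hK h10 h1π
    obtain ⟨j, hj, hj1, hj2⟩ := exists_gridIndex hK h20 h2π
    simp only [Set.mem_iUnion, exists_prop]
    refine ⟨(i, j), ?_, ⟨⟨hi1, hi2⟩, ⟨hj1, hj2⟩⟩⟩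
    by_contra hnot
    rw [hF, outerFlagged, Finset.mem_filter, Finset.mem_product, Finset.mem_range, Finset.mem_range] at hnot
    have hneg : outerVal xl A D N (i, j) < 0 := by
      by_contra hge; exact hnot ⟨⟨hi, hj⟩, not_lt.1 hge⟩
    have hneg' : (outerVal xl A D N (i, j) : ℝ) < 0 := by exact_mod_cast hneg
    simp only [outerVal, Rat.cast_sub, Rat.cast_mul, Rat.cast_add, Rat.cast_ofNat] at hneg'
    set x := halfSq k1
    set y := halfSq k2
    have hxl : (xl i : ℝ) ≤ x := (hG i hi.le).2.1.trans (halfSq_mono (gridPt_nonneg K i) hi1 h1π)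
    have hyl : (xl j : ℝ) ≤ y := (hG j hj.le).2.1.trans (halfSq_mono (gridPt_nonneg K j) hj1 h2π)
    have hxl0 : 0 ≤ (xl i : ℝ) := (hG i hi.le).1
    have hyl0 : 0 ≤ (xl j : ℝ) := (hG j hj.le).1
    have h1 := bilin_antitone (A := (A : ℝ)) hD0r hN0r hxl0 hyl0 hxl hyl
    have hocc' : 0 ≤ bilin (A : ℝ) D N x y := hocc
    unfold bilin at hocc'
    linarith
  have hle : volume (bilinRegion (A : ℝ) D N) ≤
      (F.card : ENNReal) * (ENNReal.ofReal (π / K) * ENNReal.ofReal (π / K)) := by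
    calc volume (bilinRegion (A : ℝ) D N) ≤ volume (⋃ ij ∈ F, cellIcc K ij) := measure_mono hcov
      _ ≤ ∑ ij ∈ F, volume (cellIcc K ij) := measure_biUnion_finset_le F _
      _ = (F.card : ENNReal) * (ENNReal.ofReal (π / K) * ENNReal.ofReal (π / K)) := by
          simp only [volume_cellIcc hK, Finset.sum_const, nsmul_eq_mul]
  have hreal : (volume (bilinRegion (A : ℝ) D N)).toReal ≤ (F.card : ℝ) * (π / K * (π / K)) := by
    have hne : (F.card : ENNReal) * (ENNReal.ofReal (π / K) * ENNReal.ofReal (π / K)) ≠ ⊤ :=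
      ENNReal.mul_ne_top (ENNReal.natCast_ne_top _)
        (ENNReal.mul_ne_top ENNReal.ofReal_ne_top ENNReal.ofReal_ne_top)
    have := (ENNReal.toReal_le_toReal (volume_bilinRegion_ne_top (A : ℝ) D N) hne).2 hle
    rw [ENNReal.toReal_mul, ENNReal.toReal_mul, ENNReal.toReal_natCast,
      ENNReal.toReal_ofReal (by positivity)] at this
    exact this
  unfold bilinFrac
  rw [div_le_div_iff₀ (by positivity) (by positivity)]
  have hKK : (π / K * (π / K)) * (K : ℝ) ^ 2 = π ^ 2 := by field_simp
  calc (volume (bilinRegion (A : ℝ) D N)).toReal * (K : ℝ) ^ 2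
      ≤ (F.card : ℝ) * (π / K * (π / K)) * (K : ℝ) ^ 2 := mul_le_mul_of_nonneg_right hreal (by positivity)
    _ = (F.card : ℝ) * π ^ 2 := by rw [mul_assoc, hKK]

/-! ### Row-threshold forms (kernel cost O(K)) -/

/-- ROW-THRESHOLD INNER CHECK for the bilinear region: monotone non-negative `xh`, `D, N ≥ 0`, and for every row
`i < K` a threshold `jin i ≤ K` with `0 ≤ innerVal` at the LAST cell `(i, jin i − 1)` (vacuous if `jin i = 0`). [folklore] -/
def rowInnerCheckB (K : ℕ) (xh : ℕ → ℚ) (A D N : ℚ) (jin : ℕ → ℕ) : Bool :=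
  monoTableCheck K xh && nonnegTableCheck K xh && decide (0 ≤ D) && decide (0 ≤ N) &&
  (List.range K).all fun i => decide (jin i ≤ K) && (decide (jin i = 0) || decide (0 ≤ innerVal xh A D N (i, jin i - 1)))

/-- The row-threshold cells are inner-flagged (the inner value is antitone along a row). [folklore] -/
theorem rowCells_subset_innerFlaggedB {K : ℕ} {xh : ℕ → ℚ} {A D N : ℚ} {jin : ℕ → ℕ}
    (h : rowInnerCheckB K xh A D N jin = true) : rowCells K jin ⊆ innerFlaggedB K xh A D N := by
  simp only [rowInnerCheckB, Bool.and_eq_true, decide_eq_true_eq, List.all_eq_true, List.mem_range,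
    Bool.or_eq_true] at h
  obtain ⟨⟨⟨⟨hm, h0⟩, hD⟩, hN⟩, hall⟩ := h
  have h0' := nonneg_of_nonnegTableCheck h0
  intro ij hij
  rw [mem_rowCells] at hij
  obtain ⟨hi, hj⟩ := hij
  obtain ⟨hjK, htest⟩ := hall ij.1 hi
  rcases htest with hzero | htest
  · omega
  rw [innerFlaggedB, Finset.mem_filter, Finset.mem_product, Finset.mem_range, Finset.mem_range]
  refine ⟨⟨hi, by omega⟩, ?_⟩
  have hjj : ij.2 ≤ jin ij.1 - 1 := by omega
  have hj' : jin ij.1 - 1 + 1 ≤ K := by omega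
  have hi' : ij.1 + 1 ≤ K := by omega
  have e1 := innerVal_anti hm h0' hD hN (A := A) (i := ij.1) hjj hj' hi'
  exact htest.trans e1

/-- **ROW-THRESHOLD INNER THEOREM**: `rowSum jin / K² ≤ bilinFrac A D N`. [folklore] -/
theorem rowSum_inner_le_bilinFrac {K : ℕ} (hK : 0 < K) {xl xh : ℕ → ℚ} (hG : GridEncl K xl xh)
    {A D N : ℚ} {jin : ℕ → ℕ} (hrow : rowInnerCheckB K xh A D N jin = true) :
    ((rowSum K jin : ℕ) : ℝ) / (K : ℝ) ^ 2 ≤ bilinFrac A D N := by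
  have h := hrow
  simp only [rowInnerCheckB, Bool.and_eq_true, decide_eq_true_eq] at h
  obtain ⟨⟨⟨⟨_, _⟩, hD⟩, hN⟩, _⟩ := h
  have hcard := Finset.card_le_card (rowCells_subset_innerFlaggedB hrow)
  rw [card_rowCells] at hcard
  have hcard' : ((rowSum K jin : ℕ) : ℝ) ≤ ((innerFlaggedB K xh A D N).card : ℝ) := by exact_mod_cast hcard
  exact (div_le_div_of_nonneg_right hcard' (by positivity)).trans (card_innerFlaggedB_le_bilinFrac hK hG hD hN)

/-- **ROW-THRESHOLD OUTER THEOREM**: `bilinFrac A D N ≤ rowSum jout / K²` (`EmeryFermiFillingRows.rowOuterCheck`, reused as is).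
[folklore] -/
theorem bilinFrac_le_rowSum_outer {K : ℕ} (hK : 0 < K) {xl xh : ℕ → ℚ} (hG : GridEncl K xl xh)
    {A D N : ℚ} {jout : ℕ → ℕ} (hrow : rowOuterCheck K xl A D N jout = true) :
    bilinFrac A D N ≤ ((rowSum K jout : ℕ) : ℝ) / (K : ℝ) ^ 2 := by
  have h := hrow
  simp only [rowOuterCheck, Bool.and_eq_true, decide_eq_true_eq] at h
  obtain ⟨⟨⟨⟨_, _⟩, hD⟩, hN⟩, _⟩ := h
  have hcard := Finset.card_le_card (outerFlagged_subset_rowCells hrow)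
  rw [card_rowCells] at hcard
  have hcard' : ((outerFlagged K xl A D N).card : ℝ) ≤ ((rowSum K jout : ℕ) : ℝ) := by exact_mod_cast hcard
  exact (bilinFrac_le_card_outerFlagged hK hG hD hN).trans (div_le_div_of_nonneg_right hcard' (by positivity))

end Summit.Ventures.CertifiedManyBodySolver.Downfold.Emery
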